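import Summits.CriticalPhenomena.PercolationContinuityZ3.Theorems.PercNearOneGluingNoHeavyLowerTailSunflowerMultiPetalKempeMarkedFree
import HarnessLib
import HarnessLib.Audit

/-!
# `NoHeavyLowerTail` (crux stmt-CriticalPhenomena-4575), marked-multigraph layer: **THEOREM R for marked multigraphs** (kernel-checked)

Support file (seat `prim-l12-p2` gen 49; `--supports stmt-CriticalPhenomena-4575`; continuation of `…KempeMarkedFree` (p607944) and `…KempeMarkedQSide`
(p597318); marked-multigraph port of `…KempePinned`/`…KempePinnedClasses` (p414773/p416077)).  No `sorry`; nothing is asserted about the crux.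
Memo: run/shared/lean/prim/prim-l12/prim-l12-p2/PROOF-LEMMA-B-MARKED-MULTIGRAPHS-g47.md §1 (THEOREM R).
**`QcolM_isolate_le_of_classes`**: for an UNMARKED `x` with a neighbour `w₀`, if `Q ≥ 0` for the contraction `C = (K − x)/(N(x) → w₀)` and for `C` with
`mdeg x` extra marks on `w₀`, and `T(C_A; α, p) ≥ 0` for every simply-joined neighbour `p` and other neighbour `α` (`C_A = (K − x)/(N(x) ∖ p → α)`), then
`Q(K.isolate x) ≤ 3·Q(K)`.  Proof: `3Q(K) − Q(K−x) = 3·Σ_ρ kerAbs` (p597318) grouped by the colouring of `N(x)`: (i) three colours or two saturated ones ⇒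
pointwise `≥ 0`; (ii) monochromatic ⇒ `kerAbs = lbW(type ⊕ k·e_a) + lbW(type)` and the monochromatic contraction changes no type, so the three classes sum to
`(Q(C⁺) + Q(C))/3^{|N(x)|}` (pinning, p607944); (iii) two colours with `b` on one simply-joined `p` ⇒ `kerAbs ≥ fC2 a b` (p416077) and after the colour
permutation `(a,b) ↦ (0,1)` the class sum of `fC2 a b` is `T(C_A; α, p)/3^{k}`.
-/

namespace Summit.CriticalPhenomena.PercolationContinuityZ3.Theorems.SunflowerPartition.Kempe

open Finset

/-- Two nonzero capped counts that are not both saturated: one of them is `1`. (finite check) [this work] -/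
theorem fin3_one_of_ne_zero : ∀ p q : Fin 3, p ≠ 0 → q ≠ 0 → ¬(p = 2 ∧ q = 2) → p = 1 ∨ q = 1 := by decide

namespace MGraph

variable {V : Type*} [Fintype V] [LinearOrder V] (K : MGraph V)

section TheoremR

variable (x : V)

/-- The neighbourhood of `x` (vertices joined to `x` with nonzero multiplicity). [this work] -/
def nbrs : Finset V := univ.filter fun w => K.mul x w ≠ 0

/-- The degree of `x` counted with multiplicity. [this work] -/
def mdeg : ℕ := ∑ w, K.mul x w

omit [LinearOrder V] in
/-- Membership in the neighbourhood. [this work] -/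
theorem mem_nbrs {w : V} : w ∈ K.nbrs x ↔ K.mul x w ≠ 0 := by
  unfold nbrs; simp

omit [LinearOrder V] in
/-- Neighbours are not `x` itself (no loops). [this work] -/
theorem ne_of_mem_nbrs {w : V} (h : w ∈ K.nbrs x) : w ≠ x := by
  intro e; rw [mem_nbrs, e, K.loopless] at h; exact h rfl

omit [LinearOrder V] in
/-- `x ∉ N(x)`. [this work] -/
theorem not_mem_nbrs_self : x ∉ K.nbrs x := fun h => K.ne_of_mem_nbrs x h rfl

omit [LinearOrder V] in
/-- Non-neighbours have multiplicity `0`. [this work] -/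
theorem mul_eq_zero_of_not_mem_nbrs {w : V} (hw : w ∉ K.nbrs x) : K.mul x w = 0 := by
  by_contra h; exact hw ((K.mem_nbrs x).2 h)

omit [LinearOrder V] in
/-- The profile of `x` depends only on the colours on `N(x)`. [this work] -/
theorem profM_eq_of_eqOn {ρ ρ' : V → Fin 3} (h : ∀ w ∈ K.nbrs x, ρ w = ρ' w) : K.profM x ρ = K.profM x ρ' := by
  have hl : ∀ c, K.linkM x ρ c = K.linkM x ρ' c := by
    intro c
    unfold linkM
    refine sum_congr rfl fun w _ => ?_
    by_cases hw : w ∈ K.nbrs x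
    · rw [h w hw]
    · simp [K.mul_eq_zero_of_not_mem_nbrs x hw]
  unfold profM
  rw [hl 0, hl 1, hl 2]

omit [LinearOrder V] in
/-- Coordinates of the profile. [this work] -/
theorem coord_profM (ρ : V → Fin 3) (c : Fin 3) : coord (K.profM x ρ) c = cap3 (K.linkM x ρ c + K.mark x) := by
  unfold coord profM
  fin_cases c <;> simp

omit [LinearOrder V] in
/-- A neighbour of colour `c` makes the `c`-coordinate of the profile nonzero. [this work] -/
theorem coord_profM_ne_zero {ρ : V → Fin 3} {w : V} (hw : w ∈ K.nbrs x) (c : Fin 3) (hc : ρ w = c) : coord (K.profM x ρ) c ≠ 0 := by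
  rw [coord_profM, Ne, ← eq_zero_iff_cap3]
  intro h0
  have hl : K.linkM x ρ c = 0 := by omega
  unfold linkM at hl
  have := (sum_eq_zero_iff.1 hl) w (mem_univ _)
  rw [if_pos hc] at this
  exact (K.mem_nbrs x).1 hw this

/-! ### (ii) monochromatic boundary: the kernel is `lbW` of the two contractions -/

omit [LinearOrder V] in
/-- With `N(x)` monochromatic of colour `ρ w₀` and `x` unmarked, the profile is `k·e_{ρ w₀}` with `k = mdeg x ∧ 2`. [this work] -/
theorem profM_of_mono (hmark : K.mark x = 0) (w₀ : V) (ρ : V → Fin 3) (hmono : ∀ w ∈ K.nbrs x, ρ w = ρ w₀) :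
    K.profM x ρ = xPart (ρ w₀) (cap3 (K.mdeg x), cap3 (K.mdeg x), cap3 (K.mdeg x)) := by
  have hl : ∀ c, K.linkM x ρ c = if ρ w₀ = c then K.mdeg x else 0 := by
    intro c
    unfold linkM mdeg
    by_cases hc : ρ w₀ = c
    · rw [if_pos hc]
      refine sum_congr rfl fun w _ => ?_
      by_cases hw : w ∈ K.nbrs x
      · rw [if_pos (by rw [hmono w hw, hc])]
      · simp [K.mul_eq_zero_of_not_mem_nbrs x hw]
    · rw [if_neg hc]
      refine sum_eq_zero fun w _ => ?_
      by_cases hw : w ∈ K.nbrs x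
      · rw [if_neg (by rw [hmono w hw]; exact hc)]
      · simp [K.mul_eq_zero_of_not_mem_nbrs x hw]
  unfold profM xPart
  rw [hl 0, hl 1, hl 2, hmark]
  simp only [add_zero, cap3_ite]

/-- **Monochromatic boundary**: the kernel at `ρ` is `lbW(type_{C⁺} ρ) + lbW(type_C ρ)` for the contraction `C` of `N(x)` into `w₀` and `C⁺ = C` with
`mdeg x` extra marks at `w₀`. [this work] -/
theorem kerAbs_of_mono (hmark : K.mark x = 0) {w₀ : V} (hw₀ : w₀ ∈ K.nbrs x) (ρ : V → Fin 3) (hmono : ∀ w ∈ K.nbrs x, ρ w = ρ w₀) :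
    kerAbs ((K.isolate x).ctypeM ρ) (K.profM x ρ)
      = lbW (((K.peelContract x ((K.nbrs x).erase w₀) w₀).addMark w₀ (K.mdeg x)).ctypeM ρ)
        + lbW ((K.peelContract x ((K.nbrs x).erase w₀) w₀).ctypeM ρ) := by
  have hw₀x : w₀ ≠ x := K.ne_of_mem_nbrs x hw₀
  have hC : (K.peelContract x ((K.nbrs x).erase w₀) w₀).ctypeM ρ = (K.isolate x).ctypeM ρ :=
    K.ctypeM_peelContract_of_const x w₀ _ hw₀x (notMem_erase w₀ _) (fun h => K.not_mem_nbrs_self x (mem_of_mem_erase h)) ρ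
      (fun s hs => hmono s (mem_of_mem_erase hs))
  rw [ctypeM_addMark, hC, K.profM_of_mono x hmark w₀ ρ hmono, kerAbs_const]

/-- **Counting a graph whose free vertices are pinned on the monochromatic boundary classes**: if `x` and `N(x) ∖ w₀` are free in `C`, then
`Q(C) = 3^{|N(x)|} · Σ_{ρ x = 0, ρ constant on N(x)} lbW(type_C ρ)`. [this work] -/
theorem QcolM_eq_pow_mul_mono (C : MGraph V) {w₀ : V} (hw₀ : w₀ ∈ K.nbrs x)
    (hfree : ∀ z ∈ insert x ((K.nbrs x).erase w₀), C.IsFree z) :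
    C.QcolM = 3 ^ (insert x ((K.nbrs x).erase w₀)).card *
      ∑ ρ ∈ univ.filter (fun ρ : V → Fin 3 => ρ x = 0 ∧ ∀ w ∈ K.nbrs x, ρ w = ρ w₀), lbW (C.ctypeM ρ) := by
  have hw₀x : w₀ ≠ x := K.ne_of_mem_nbrs x hw₀
  have hw₀Z : w₀ ∉ insert x ((K.nbrs x).erase w₀) := by
    rw [mem_insert, not_or]; exact ⟨hw₀x, notMem_erase w₀ _⟩
  have h1 := C.sum_filter_eq_pow_mul lbW (insert x ((K.nbrs x).erase w₀)) hfree (fun _ => True) (fun _ _ _ _ => Iff.rfl)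
    (fun z ρ => if z = x then 0 else ρ w₀) (fun z _ z' hz' ρ c => by
      have hne : w₀ ≠ z' := fun e => hw₀Z (e ▸ hz')
      simp only [Function.update_of_ne hne])
  simp only [filter_true, true_and] at h1
  unfold QcolM
  rw [h1]
  congr 1
  refine sum_congr ?_ fun _ _ => rfl
  ext ρ
  simp only [mem_filter, mem_univ, true_and, forall_mem_insert, if_true, mem_erase]
  constructor
  · rintro ⟨hx, hrest⟩
    refine ⟨hx, fun w hw => ?_⟩
    by_cases hww : w = w₀
    · rw [hww]
    · have := hrest w ⟨hww, hw⟩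
      rwa [if_neg (K.ne_of_mem_nbrs x hw)] at this
  · rintro ⟨hx, hmono⟩
    refine ⟨hx, fun w hw => ?_⟩
    rw [if_neg (K.ne_of_mem_nbrs x hw.2)]
    exact hmono w hw.2

/-! ### (iii) two-colour boundary: the class is a two-terminal functional of a contraction -/

/-- **Two-colour boundary class** (colour `a` on the neighbours other than the simply-joined `b`-neighbour): the class sum of the kernel over the
colourings agreeing with `ρ₀` on `N(x)` is `≥ 0`, given `T ≥ 0` for the contractions `(K − x)/(N(x) ∖ p → α)`. [this work] -/
theorem sum_twoColour_nonneg (hmark : K.mark x = 0)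
    (hT : ∀ p α : V, K.mul x p = 1 → α ≠ p → K.mul x α ≠ 0 → 0 ≤ (K.peelContract x (((K.nbrs x).erase p).erase α) α).TfunM α p)
    (ρ₀ : V → Fin 3) (a b : Fin 3) (hab : a ≠ b) {α : V} (hα : α ∈ K.nbrs x) (hαa : ρ₀ α = a)
    (hcols : ∀ w ∈ K.nbrs x, ρ₀ w = a ∨ ρ₀ w = b) (hb1 : coord (K.profM x ρ₀) b = 1) :
    0 ≤ ∑ ρ ∈ univ.filter (fun ρ : V → Fin 3 => ρ x = 0 ∧ ∀ w ∈ K.nbrs x, ρ w = ρ₀ w),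
        kerAbs ((K.isolate x).ctypeM ρ) (K.profM x ρ) := by
  -- the unique `b`-coloured neighbour `p`, simply joined
  have hlink : K.linkM x ρ₀ b = 1 := by
    rw [coord_profM, hmark, add_zero, ← eq_one_iff_cap3] at hb1; exact hb1
  have hlink' : (∑ w, if ρ₀ w = b then K.mul x w else 0) = 1 := hlink
  obtain ⟨p, -, hp⟩ := exists_ne_zero_of_sum_ne_zero (by rw [hlink']; exact one_ne_zero)
  have hpb : ρ₀ p = b := by by_contra h; rw [if_neg h] at hp; exact hp rfl
  rw [if_pos hpb] at hp
  have hpn : p ∈ K.nbrs x := (K.mem_nbrs x).2 hp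
  have hpx : p ≠ x := K.ne_of_mem_nbrs x hpn
  have hsplit := sum_erase_add univ (fun w => if ρ₀ w = b then K.mul x w else 0) (mem_univ p)
  rw [hlink'] at hsplit
  simp only [if_pos hpb] at hsplit
  have hxp1 : K.mul x p = 1 := by omega
  have hzero : ∑ w ∈ univ.erase p, (if ρ₀ w = b then K.mul x w else 0) = 0 := by omega
  have hcolA : ∀ w ∈ K.nbrs x, w ≠ p → ρ₀ w = a := by
    intro w hw hwp
    rcases hcols w hw with h | h
    · exact h
    · exfalso
      have := (sum_eq_zero_iff.1 hzero) w (mem_erase.2 ⟨hwp, mem_univ _⟩)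
      rw [if_pos h] at this
      exact (K.mem_nbrs x).1 hw this
  have hαp : α ≠ p := fun e => hab (by rw [← hαa, e, hpb])
  have hαx : α ≠ x := K.ne_of_mem_nbrs x hα
  set S := ((K.nbrs x).erase p).erase α with hS
  have hαS : α ∉ S := notMem_erase α _
  have hpS : p ∉ S := fun h => notMem_erase p _ (mem_of_mem_erase h)
  have hxS : x ∉ S := fun h => K.not_mem_nbrs_self x (mem_of_mem_erase (mem_of_mem_erase h))
  have hmemS : ∀ s ∈ S, s ∈ K.nbrs x ∧ s ≠ p ∧ s ≠ α := fun s hs =>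
    ⟨mem_of_mem_erase (mem_of_mem_erase hs), (mem_erase.1 (mem_of_mem_erase hs)).1, (mem_erase.1 hs).1⟩
  set C := K.peelContract x S α with hC
  have hpos := hT p α hxp1 hαp ((K.mem_nbrs x).1 hα)
  -- pointwise: kerAbs ≥ fC2 a b on the class
  have hthird : ∀ c, c ≠ a → c ≠ b → coord (K.profM x ρ₀) c = 0 := by
    intro c hca hcb
    rw [coord_profM, hmark, add_zero, ← eq_zero_iff_cap3]
    unfold linkM
    refine sum_eq_zero fun w _ => ?_
    by_cases hw : w ∈ K.nbrs x
    · rw [if_neg]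
      intro hwc
      rcases hcols w hw with h | h
      · exact hca (hwc.symm.trans h)
      · exact hcb (hwc.symm.trans h)
    · simp [K.mul_eq_zero_of_not_mem_nbrs x hw]
  have ha0 : coord (K.profM x ρ₀) a ≠ 0 := K.coord_profM_ne_zero x hα a hαa
  have hpt : ∀ ρ ∈ univ.filter (fun ρ : V → Fin 3 => ρ x = 0 ∧ ∀ w ∈ K.nbrs x, ρ w = ρ₀ w),
      fC2 a b ((K.isolate x).ctypeM ρ) ≤ kerAbs ((K.isolate x).ctypeM ρ) (K.profM x ρ) := by
    intro ρ hρ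
    obtain ⟨-, hag⟩ := (mem_filter.1 hρ).2
    rw [K.profM_eq_of_eqOn x hag]
    exact fC2_le_kerAbs a b _ _ hab ha0 hb1 hthird
  refine le_trans ?_ (sum_le_sum hpt)
  -- the colour permutation (a, b) ↦ (0, 1) and the pinned form of T(C; α, p)
  obtain ⟨ψ, π, hψ0, hψ1, hπψ, hψπ⟩ := exists_colourPerm a b hab
  have hinj : ∀ c c', ψ c = ψ c' → c = c' := fun c c' h => by rw [← hπψ c, ← hπψ c', h]
  have hZfree : ∀ z ∈ insert x S, C.IsFree z := by
    intro z hz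
    rcases mem_insert.1 hz with h | h
    · rw [h]; exact K.isFree_peelContract_self x α S
    · exact K.isFree_peelContract_of_mem x α S h
  have hαZ : α ∉ insert x S := by rw [mem_insert, not_or]; exact ⟨hαx, hαS⟩
  have hpZ : p ∉ insert x S := by rw [mem_insert, not_or]; exact ⟨hpx, hpS⟩
  have hTpin := C.sum_filter_eq_pow_mul fC (insert x S) hZfree (fun σ => σ α = 0 ∧ σ p = 1) (fun z hz σ c => by
      rw [Function.update_of_ne (ne_of_mem_of_not_mem hz hαZ).symm, Function.update_of_ne (ne_of_mem_of_not_mem hz hpZ).symm])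
    (fun z _ => if z = x then π 0 else 0) (fun _ _ _ _ _ _ => rfl)
  have hTdef : C.TfunM α p = ∑ σ ∈ univ.filter (fun σ : V → Fin 3 => σ α = 0 ∧ σ p = 1), fC (C.ctypeM σ) := rfl
  have hbij : ∑ ρ ∈ univ.filter (fun ρ : V → Fin 3 => ρ x = 0 ∧ ∀ w ∈ K.nbrs x, ρ w = ρ₀ w), fC2 a b ((K.isolate x).ctypeM ρ)
      = ∑ σ ∈ univ.filter (fun σ : V → Fin 3 => (σ α = 0 ∧ σ p = 1) ∧ ∀ z ∈ insert x S, σ z = (if z = x then π 0 else 0)),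
          fC (C.ctypeM σ) := by
    refine sum_nbij' (fun ρ w => π (ρ w)) (fun σ w => ψ (σ w)) ?_ ?_ ?_ ?_ ?_
    · intro ρ hρ
      obtain ⟨hx, hag⟩ := (mem_filter.1 hρ).2
      simp only [mem_filter, mem_univ, true_and, forall_mem_insert, if_true]
      refine ⟨⟨by rw [hag α hα, hαa, ← hψ0, hπψ], by rw [hag p hpn, hpb, ← hψ1, hπψ]⟩, by rw [hx], fun z hz => ?_⟩
      obtain ⟨hzn, hzp, -⟩ := hmemS z hz
      rw [if_neg (K.ne_of_mem_nbrs x hzn), hag z hzn, hcolA z hzn hzp, ← hψ0, hπψ]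
    · intro σ hσ
      obtain ⟨⟨hσα, hσp⟩, hpin⟩ := (mem_filter.1 hσ).2
      simp only [mem_filter, mem_univ, true_and]
      refine ⟨by rw [hpin x (mem_insert_self x S), if_pos rfl, hψπ], fun w hw => ?_⟩
      by_cases hwp : w = p
      · rw [hwp, hσp, hψ1, hpb]
      · by_cases hwα : w = α
        · rw [hwα, hσα, hψ0, hαa]
        · have hwS : w ∈ S := mem_erase.2 ⟨hwα, mem_erase.2 ⟨hwp, hw⟩⟩
          rw [hpin w (mem_insert_of_mem hwS), if_neg (K.ne_of_mem_nbrs x hw), hψ0, hcolA w hw hwp]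
    · intro ρ _
      funext w
      exact hψπ (ρ w)
    · intro σ _
      funext w
      exact hπψ (σ w)
    · intro ρ hρ
      obtain ⟨-, hag⟩ := (mem_filter.1 hρ).2
      have hconst : ∀ s ∈ S, ρ s = ρ α := by
        intro s hs
        obtain ⟨hsn, hsp, -⟩ := hmemS s hs
        rw [hag s hsn, hag α hα, hcolA s hsn hsp, hαa]
      rw [C.ctypeM_comp_perm π ψ hπψ hψπ ρ, fC_permCT ψ hinj, hψ0, hψ1, hC, K.ctypeM_peelContract_of_const x α S hαx hαS hxS ρ hconst]
  rw [hbij]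
  have h3 : (0 : ℤ) < 3 ^ (insert x S).card := by positivity
  rw [hTdef, hTpin] at hpos
  exact (mul_nonneg_iff_of_pos_left h3).1 hpos

/-- **A non-monochromatic boundary class is nonnegative** (cases (i) and (iii) of THEOREM R). [this work] -/
theorem sum_class_nonneg (hmark : K.mark x = 0) {w₀ : V} (hw₀ : w₀ ∈ K.nbrs x)
    (hT : ∀ p α : V, K.mul x p = 1 → α ≠ p → K.mul x α ≠ 0 → 0 ≤ (K.peelContract x (((K.nbrs x).erase p).erase α) α).TfunM α p)
    (ρ₀ : V → Fin 3) (hnm : ¬ ∀ w ∈ K.nbrs x, ρ₀ w = ρ₀ w₀) :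
    0 ≤ ∑ ρ ∈ univ.filter (fun ρ : V → Fin 3 => ρ x = 0 ∧ ∀ w ∈ K.nbrs x, ρ w = ρ₀ w),
        kerAbs ((K.isolate x).ctypeM ρ) (K.profM x ρ) := by
  push Not at hnm
  obtain ⟨w₁, hw₁, hne⟩ := hnm
  have ha : coord (K.profM x ρ₀) (ρ₀ w₀) ≠ 0 := K.coord_profM_ne_zero x hw₀ _ rfl
  have hb : coord (K.profM x ρ₀) (ρ₀ w₁) ≠ 0 := K.coord_profM_ne_zero x hw₁ _ rfl
  by_cases hall : ∀ c, coord (K.profM x ρ₀) c ≠ 0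
  · -- (i) all colours present: pointwise
    refine sum_nonneg fun ρ hρ => ?_
    obtain ⟨-, hag⟩ := (mem_filter.1 hρ).2
    rw [K.profM_eq_of_eqOn x hag]
    exact kerAbs_nonneg_of_coord_ne_zero _ _ hall
  push Not at hall
  obtain ⟨c₀, hc₀⟩ := hall
  have hc₀a : c₀ ≠ ρ₀ w₀ := fun e => ha (e ▸ hc₀)
  have hc₀b : c₀ ≠ ρ₀ w₁ := fun e => hb (e ▸ hc₀)
  -- every neighbour is coloured like w₀ or like w₁
  have hcols : ∀ w ∈ K.nbrs x, ρ₀ w = ρ₀ w₀ ∨ ρ₀ w = ρ₀ w₁ := by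
    intro w hw
    by_contra hh
    push Not at hh
    have hwc : coord (K.profM x ρ₀) (ρ₀ w) ≠ 0 := K.coord_profM_ne_zero x hw _ rfl
    have : ρ₀ w = c₀ := fin3_third_unique (ρ₀ w₀) (ρ₀ w₁) (ρ₀ w) c₀ hne.symm hh.1 hh.2 hc₀a hc₀b
    exact hwc (this ▸ hc₀)
  by_cases h22 : coord (K.profM x ρ₀) (ρ₀ w₀) = 2 ∧ coord (K.profM x ρ₀) (ρ₀ w₁) = 2
  · -- (i') two saturated colours: pointwise
    refine sum_nonneg fun ρ hρ => ?_
    obtain ⟨-, hag⟩ := (mem_filter.1 hρ).2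
    rw [K.profM_eq_of_eqOn x hag]
    exact kerAbs_nonneg_of_coord_two_two _ _ _ _ hne.symm h22.1 h22.2
  · -- (iii) one of the two colours is carried by a single simply-joined neighbour
    rcases fin3_one_of_ne_zero _ _ ha hb h22 with h1 | h1
    · exact K.sum_twoColour_nonneg x hmark hT ρ₀ (ρ₀ w₁) (ρ₀ w₀) hne hw₁ rfl (fun w hw => (hcols w hw).symm) h1
    · exact K.sum_twoColour_nonneg x hmark hT ρ₀ (ρ₀ w₀) (ρ₀ w₁) hne.symm hw₀ rfl hcols h1

/-! ### THEOREM R -/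

/-- The boundary key of a colouring: its values on `N(x)`, zero elsewhere. [this work] -/
def nbKeyM (ρ : V → Fin 3) : V → Fin 3 := fun w => if w ∈ K.nbrs x then ρ w else 0

/-- **THEOREM R FOR MARKED MULTIGRAPHS (one vertex, kernel-checked)**: for an UNMARKED vertex `x` with a neighbour `w₀`, if `Q ≥ 0` holds for the
contraction `(K − x)/(N(x) → w₀)` with and without `mdeg x` extra marks at `w₀`, and `T(·; α, p) ≥ 0` holds for every contraction `(K − x)/(N(x) ∖ p → α)`
with `p` a simply-joined neighbour and `α ≠ p` another neighbour, then `Q(K.isolate x) ≤ 3·Q(K)` — i.e. `Q(K − x) ≤ Q(K)`. [this work] -/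
theorem QcolM_isolate_le_of_classes (hmark : K.mark x = 0) {w₀ : V} (hw₀ : K.mul x w₀ ≠ 0)
    (hQ : 0 ≤ (K.peelContract x ((K.nbrs x).erase w₀) w₀).QcolM)
    (hQ' : 0 ≤ ((K.peelContract x ((K.nbrs x).erase w₀) w₀).addMark w₀ (K.mdeg x)).QcolM)
    (hT : ∀ p α : V, K.mul x p = 1 → α ≠ p → K.mul x α ≠ 0 → 0 ≤ (K.peelContract x (((K.nbrs x).erase p).erase α) α).TfunM α p) :
    (K.isolate x).QcolM ≤ 3 * K.QcolM := by
  have hw₀n : w₀ ∈ K.nbrs x := (K.mem_nbrs x).2 hw₀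
  have hw₀x : w₀ ≠ x := K.ne_of_mem_nbrs x hw₀n
  have h := K.three_mul_QcolM_sub_QcolM_isolate x
  suffices hnn : 0 ≤ ∑ τ : (({x}ᶜ : Set V)) → Fin 3, kerAbs ((K.isolate x).ctypeM (extCol x τ 0)) (K.profM x (extCol x τ 0)) by linarith
  have hre : ∑ τ : (({x}ᶜ : Set V)) → Fin 3, kerAbs ((K.isolate x).ctypeM (extCol x τ 0)) (K.profM x (extCol x τ 0))
      = ∑ ρ ∈ univ.filter (fun ρ : V → Fin 3 => ρ x = 0), kerAbs ((K.isolate x).ctypeM ρ) (K.profM x ρ) := by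
    refine sum_nbij' (fun τ => extCol x τ 0) (fun ρ => ρ ∘ Subtype.val) (fun τ _ => ?_) (fun _ _ => mem_univ _)
      (fun τ _ => extCol_comp_val x τ 0) (fun ρ hρ => ?_) (fun _ _ => rfl)
    · simp only [mem_filter, mem_univ, true_and]
      exact extCol_self x τ 0
    · have hx : ρ x = 0 := (mem_filter.1 hρ).2
      have := extCol_restrict x ρ
      rw [hx] at this
      exact this
  rw [hre, ← sum_filter_add_sum_filter_not (univ.filter fun ρ : V → Fin 3 => ρ x = 0) (fun ρ => ∀ w ∈ K.nbrs x, ρ w = ρ w₀),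
    filter_filter, filter_filter]
  refine add_nonneg ?_ ?_
  · -- (ii) the three monochromatic classes together: (Q(C⁺) + Q(C)) / 3^{|N(x)|}
    rw [sum_congr rfl (fun ρ hρ => K.kerAbs_of_mono x hmark hw₀n ρ ((mem_filter.1 hρ).2).2), sum_add_distrib]
    have hfreeC : ∀ z ∈ insert x ((K.nbrs x).erase w₀), (K.peelContract x ((K.nbrs x).erase w₀) w₀).IsFree z := by
      intro z hz
      rcases mem_insert.1 hz with e | e
      · rw [e]; exact K.isFree_peelContract_self x w₀ _
      · exact K.isFree_peelContract_of_mem x w₀ _ e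
    have hfreeC' : ∀ z ∈ insert x ((K.nbrs x).erase w₀), ((K.peelContract x ((K.nbrs x).erase w₀) w₀).addMark w₀ (K.mdeg x)).IsFree z := by
      intro z hz
      have hzw : z ≠ w₀ := by
        rcases mem_insert.1 hz with e | e
        · rw [e]; exact hw₀x.symm
        · exact (mem_erase.1 e).1
      exact isFree_addMark _ w₀ _ (hfreeC z hz) hzw
    have e1 := K.QcolM_eq_pow_mul_mono x _ hw₀n hfreeC
    have e2 := K.QcolM_eq_pow_mul_mono x _ hw₀n hfreeC'
    have h3 : (0 : ℤ) < 3 ^ (insert x ((K.nbrs x).erase w₀)).card := by positivity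
    rw [e1] at hQ
    rw [e2] at hQ'
    exact add_nonneg ((mul_nonneg_iff_of_pos_left h3).1 hQ') ((mul_nonneg_iff_of_pos_left h3).1 hQ)
  · -- non-monochromatic classes, one boundary colouring at a time
    rw [← sum_fiberwise (univ.filter fun ρ : V → Fin 3 => ρ x = 0 ∧ ¬∀ w ∈ K.nbrs x, ρ w = ρ w₀) (K.nbKeyM x) _]
    refine sum_nonneg fun κ _ => ?_
    by_cases hne : ((univ.filter fun ρ : V → Fin 3 => ρ x = 0 ∧ ¬∀ w ∈ K.nbrs x, ρ w = ρ w₀).filter fun ρ => K.nbKeyM x ρ = κ).Nonempty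
    · obtain ⟨ρ₀, hρ₀⟩ := hne
      obtain ⟨h0, hk0⟩ := mem_filter.1 hρ₀
      obtain ⟨-, hnm⟩ := (mem_filter.1 h0).2
      have hfib : ((univ.filter fun ρ : V → Fin 3 => ρ x = 0 ∧ ¬∀ w ∈ K.nbrs x, ρ w = ρ w₀).filter fun ρ => K.nbKeyM x ρ = κ)
          = univ.filter (fun ρ : V → Fin 3 => ρ x = 0 ∧ ∀ w ∈ K.nbrs x, ρ w = ρ₀ w) := by
        ext ρ
        simp only [mem_filter, mem_univ, true_and]
        constructor
        · rintro ⟨⟨hx, -⟩, hk⟩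
          refine ⟨hx, fun w hw => ?_⟩
          have e1 := congrFun hk w
          have e2 := congrFun hk0 w
          unfold nbKeyM at e1 e2
          rw [if_pos hw] at e1 e2
          rw [e1, e2]
        · rintro ⟨hx, hag⟩
          refine ⟨⟨hx, fun hmono => hnm fun w hw => ?_⟩, ?_⟩
          · rw [← hag w hw, ← hag w₀ hw₀n]; exact hmono w hw
          · rw [← hk0]
            funext w
            unfold nbKeyM
            by_cases hw : w ∈ K.nbrs x
            · rw [if_pos hw, if_pos hw, hag w hw]
            · rw [if_neg hw, if_neg hw]
      rw [hfib]
      exact K.sum_class_nonneg x hmark hw₀n hT ρ₀ hnm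
    · rw [not_nonempty_iff_eq_empty.1 hne, sum_empty]

end TheoremR

end MGraph

end Summit.CriticalPhenomena.PercolationContinuityZ3.Theorems.SunflowerPartition.Kempe
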